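import Summits.ValiantsHypothesis.ValiantsHypothesis.Theses.AlgebraicKWGames
import Literature.Computability.AlgebraicComplexity.VNCTwoProofs

/-!
# AlgebraicKWGames, crux `VPLogSquaredDepth` (stmt-ValiantsHypothesis-10297) — PROVED by citation

Route `AlgebraicKWGames` of `ValiantsHypothesis`, crux #2 `VPLogSquaredDepth` ("VP = VNC² in the
tree's circuit model: every VP family over `ℂ` has fan-in-two `ArithCircuit`s of depth
`≤ c·(⌊log₂ n⌋+1)²`", the planner's "KNOWN theorem, unproved in Lean and the only unproved ingredient
of the assembly's cone").  It IS proved in Lean now: the Literature fact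
`BCS1997_cor_21_38_VP_subset_VNC2` (Bürgisser–Clausen–Shokrollahi 1997, Cor. (21.38) `VP = VNC²`,
via Thm. (21.36) of Hyafil / Valiant–Skyum–Berkowitz–Rackoff; `VNCTwo.lean`) has been DISCHARGED
over every commutative semiring in `VNCTwoProofs.lean`
(`BCS1997_cor_21_38_VP_subset_VNC2_holds`, from
`DepthReduction.exists_isPBounded_size_depth_le_of_isVPFamily`), and the item is that fact at
`k = ℂ` with the size clause dropped (`BCS1997_cor_21_38_VP_subset_VNC2.depth_only`), exactly as the
grounder recorded (2026-08-15).  This file closes the item by citation.  Honest framing: the other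
crux of the route, `KWPerLowerBound`, is an open problem at least as strong as the extended Valiant
hypothesis; VP ≠ VNP is NOT proved and nothing here is progress on it.
-/

noncomputable section

-- the summit and the problem share the name `ValiantsHypothesis` (D-0017 single-conjunct layout)
set_option linter.dupNamespace false

namespace Summit.ValiantsHypothesis.ValiantsHypothesis.Theorems.AlgebraicKWGames

open Literature.Computability.AlgebraicComplexity

/-- **`VPLogSquaredDepth` (stmt-ValiantsHypothesis-10297):** every VP family over `ℂ` has
fan-in-two circuits of depth `≤ c·(⌊log₂ n⌋+1)²` — the depth clause of the discharged Literature
fact `BCS1997_cor_21_38_VP_subset_VNC2` (`VP ⊆ VNC²`, BCS 1997 Cor. (21.38)) at `k = ℂ`. -/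
theorem vpLogSquaredDepth_proof :
    Summit.ValiantsHypothesis.ValiantsHypothesis.Theses.AlgebraicKWGames.VPLogSquaredDepth :=
  fun f hf => BCS1997_cor_21_38_VP_subset_VNC2.depth_only BCS1997_cor_21_38_VP_subset_VNC2_holds ℂ f hf

end Summit.ValiantsHypothesis.ValiantsHypothesis.Theorems.AlgebraicKWGames
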